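import Summits.HodgeConjecture.HodgeCM.PerL34.FockHermiteL2_1

/-! PORT of `HodgeCM/PerL34/FockHermiteL2.lean` (HodgeCMPerL run 82) — part 2: continuation of `Summits.HodgeConjecture.HodgeCM.PerL34.FockHermiteL2_1` (split at a top-level declaration boundary by port_pkg.py; scope re-opened below; declarations unchanged). -/

-- port_pkg: scope re-opened for this part (file-level context, then the namespace/section stack open at the cut)
set_option autoImplicit false
open MvPolynomial Complex MeasureTheory
open scoped Real
namespace HodgeCM.PerL34.Fock.Hermite
noncomputable section
section NDim
variable {σ : Type*} [Fintype σ] [DecidableEq σ]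
/-- **Folland §1.7 (vii), orthonormality, on symbols**: `⟪h_α, h_β⟫ = ∫ h_α h_β = δ_{αβ}`.  Proof exactly as in
Folland: adjointness of `Z_j^*`/`Z_j`, the ladder (1.82), `Z_j h_0 = 0` and `‖h_0‖ = 1`. -/
theorem gip_herm (α β : σ →₀ ℕ) : gip (herm α) (herm β) = if α = β then 1 else 0 := by
  suffices h : ∀ (n : ℕ) (α β : σ →₀ ℕ), mdeg α = n → gip (herm α) (herm β) = if α = β then 1 else 0 from
    h _ α β rfl
  intro n
  induction n with
  | zero =>
      intro α β hα
      rw [mdeg_eq_zero_iff] at hα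
      subst hα
      by_cases hβ : β = 0
      · subst hβ
        rw [herm_zero, if_pos rfl]
        exact gip_vac
      · rw [if_neg (Ne.symm hβ)]
        obtain ⟨j, hj⟩ : ∃ j, β j ≠ 0 := by
          by_contra hcon
          push Not at hcon
          exact hβ (Finsupp.ext hcon)
        have hs := opZs_herm j (β - Finsupp.single j 1)
        rw [Finsupp.sub_add_single_one_cancel hj] at hs
        have hsne : (Real.sqrt (((β - Finsupp.single j 1 : σ →₀ ℕ) j + 1) / π) : ℂ) ≠ 0 :=
          Complex.ofReal_ne_zero.mpr (Real.sqrt_pos.mpr (by positivity)).ne'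
        have hβeq : herm β = (Real.sqrt (((β - Finsupp.single j 1 : σ →₀ ℕ) j + 1) / π) : ℂ)⁻¹ •
            opZs j (herm (β - Finsupp.single j 1)) := by
          rw [hs, smul_smul, inv_mul_cancel₀ hsne, one_smul]
        rw [hβeq, gip_smul_right, gip_comm, gip_opZs, herm_zero, opZ_vac, gip_zero_right, mul_zero]
  | succ n ih =>
      intro α β hα
      obtain ⟨j, hj⟩ : ∃ j, α j ≠ 0 := by
        by_contra hcon
        push Not at hcon
        have h0 : α = 0 := Finsupp.ext hcon
        rw [h0, (mdeg_eq_zero_iff (0 : σ →₀ ℕ)).mpr rfl] at hα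
        exact Nat.succ_ne_zero n hα.symm
      have hαeq : (α - Finsupp.single j 1) + Finsupp.single j 1 = α := Finsupp.sub_add_single_one_cancel hj
      have hdeg : mdeg (α - Finsupp.single j 1) = n := by
        have h := mdeg_add_single (α - Finsupp.single j 1) j
        rw [hαeq, hα] at h
        omega
      have hs := opZs_herm j (α - Finsupp.single j 1)
      rw [hαeq] at hs
      have hsne : (Real.sqrt (((α - Finsupp.single j 1 : σ →₀ ℕ) j + 1) / π) : ℂ) ≠ 0 :=
        Complex.ofReal_ne_zero.mpr (Real.sqrt_pos.mpr (by positivity)).ne'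
      have hαeq' : herm α = (Real.sqrt (((α - Finsupp.single j 1 : σ →₀ ℕ) j + 1) / π) : ℂ)⁻¹ •
          opZs j (herm (α - Finsupp.single j 1)) := by
        rw [hs, smul_smul, inv_mul_cancel₀ hsne, one_smul]
      rw [hαeq', gip_smul_left, gip_opZs, opZ_herm, gip_smul_right, ih _ (β - Finsupp.single j 1) hdeg]
      by_cases hb : β j = 0
      · have hne : α ≠ β := fun h => hj (by rw [h, hb])
        rw [hb, Nat.cast_zero, zero_div, Real.sqrt_zero, Complex.ofReal_zero, zero_mul, mul_zero, if_neg hne]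
      · have hβeq : (β - Finsupp.single j 1) + Finsupp.single j 1 = β := Finsupp.sub_add_single_one_cancel hb
        by_cases hab : α = β
        · have hin : α - Finsupp.single j 1 = β - Finsupp.single j 1 := by rw [hab]
          rw [if_pos hab, if_pos hin, mul_one]
          have hαj : ((α - Finsupp.single j 1 : σ →₀ ℕ) j : ℝ) + 1 = (β j : ℝ) := by
            have h := congrArg (fun γ : σ →₀ ℕ => γ j) hαeq
            simp only [Finsupp.add_apply, Finsupp.single_eq_same] at h
            rw [← hab]
            exact_mod_cast h
          rw [← hαj, inv_mul_cancel₀ hsne]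
        · have hout : α - Finsupp.single j 1 ≠ β - Finsupp.single j 1 := by
            intro h
            exact hab (by rw [← hαeq, h, hβeq])
          rw [if_neg hab, if_neg hout, mul_zero, mul_zero]

/-! ### Real coefficients and the L² statement -/

omit [Fintype σ] [DecidableEq σ] in
/-- Complex conjugation of coefficients commutes with `Z_j^*` (whose coefficients `2`, `(2π)⁻¹` are real). -/
theorem map_conj_opZs (j : σ) (p : MvPolynomial σ ℂ) :
    MvPolynomial.map (starRingEnd ℂ) (opZs j p) = opZs j (MvPolynomial.map (starRingEnd ℂ) p) := by
  have h2 : starRingEnd ℂ (2 : ℂ) = 2 := map_ofNat _ 2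
  have hπ : starRingEnd ℂ ((2 * π : ℂ)⁻¹) = (2 * π : ℂ)⁻¹ := by
    rw [map_inv₀, RingHom.map_mul, h2, Complex.conj_ofReal]
  rw [opZs_apply, opZs_apply, RingHom.map_sub, smul_eq_C_mul, smul_eq_C_mul, smul_eq_C_mul, smul_eq_C_mul,
    RingHom.map_mul, RingHom.map_mul, RingHom.map_mul, map_C, map_C, map_X, ← pderiv_map, h2, hπ]

/-- The creation polynomials `B⁻¹ z^β` have real coefficients. -/
theorem map_conj_binv_monomial (β : σ →₀ ℕ) :
    MvPolynomial.map (starRingEnd ℂ) (binv (monomial β (1 : ℂ))) = binv (monomial β 1) := by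
  suffices h : ∀ (n : ℕ) (β : σ →₀ ℕ), mdeg β = n →
      MvPolynomial.map (starRingEnd ℂ) (binv (monomial β (1 : ℂ))) = binv (monomial β 1) from h _ β rfl
  intro n
  induction n with
  | zero =>
      intro β hβ
      rw [mdeg_eq_zero_iff] at hβ
      subst hβ
      rw [show (monomial (0 : σ →₀ ℕ) (1 : ℂ) : MvPolynomial σ ℂ) = 1 from rfl, binv_one, vac, map_C,
        Complex.conj_ofReal]
  | succ n ih =>
      intro β hβ
      obtain ⟨j, hj⟩ : ∃ j, β j ≠ 0 := by
        by_contra hcon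
        push Not at hcon
        have h0 : β = 0 := Finsupp.ext hcon
        rw [h0, (mdeg_eq_zero_iff (0 : σ →₀ ℕ)).mpr rfl] at hβ
        exact Nat.succ_ne_zero n hβ.symm
      have hβeq : (β - Finsupp.single j 1) + Finsupp.single j 1 = β := Finsupp.sub_add_single_one_cancel hj
      have hdeg : mdeg (β - Finsupp.single j 1) = n := by
        have h := mdeg_add_single (β - Finsupp.single j 1) j
        rw [hβeq, hβ] at h
        omega
      rw [← hβeq, ← X_mul_monomial_one, binv_X_mul, map_conj_opZs, ih _ hdeg]

/-- The Hermite symbols `herm β` have real coefficients. -/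
theorem map_conj_herm (β : σ →₀ ℕ) : MvPolynomial.map (starRingEnd ℂ) (herm β) = herm β := by
  rw [herm_eq, smul_eq_C_mul, RingHom.map_mul, map_C, Complex.conj_ofReal, map_conj_binv_monomial]

omit [DecidableEq σ] in
/-- Conjugating a Hermite-type function conjugates the coefficients of its symbol. -/
theorem conj_hermiteFun (p : MvPolynomial σ ℂ) (x : σ → ℝ) :
    starRingEnd ℂ (hermiteFun p x) = hermiteFun (MvPolynomial.map (starRingEnd ℂ) p) x := by
  have hg : starRingEnd ℂ (gauss x) = gauss x := by
    rw [gauss, ← Complex.exp_conj, RingHom.map_mul, RingHom.map_neg, Complex.conj_ofReal, map_sum]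
    congr 2
    refine Finset.sum_congr rfl fun k _ => ?_
    rw [RingHom.map_pow, Complex.conj_ofReal]
  have he : starRingEnd ℂ (eval (fun k => (x k : ℂ)) p) =
      eval (fun k => (x k : ℂ)) (MvPolynomial.map (starRingEnd ℂ) p) := by
    rw [eval_map]
    change starRingEnd ℂ (eval₂ (RingHom.id ℂ) (fun k => (x k : ℂ)) p) = _
    rw [eval₂_comp_left, RingHom.comp_id]
    congr 1
    funext k
    exact Complex.conj_ofReal (x k)
  rw [hermiteFun, hermiteFun, RingHom.map_mul, hg, he]

omit [DecidableEq σ] in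
/-- (Ported verbatim from the HodgeCMPerL package; no docstring in the source.) -/
theorem hermiteFun_mul_hermiteFun (p q : MvPolynomial σ ℂ) (x : σ → ℝ) :
    hermiteFun p x * hermiteFun q x = eval (fun k => (x k : ℂ)) (p * q) * gauss2 x := by
  rw [hermiteFun, hermiteFun, map_mul, ← gauss_mul_gauss]
  ring

omit [DecidableEq σ] in
/-- The Gaussian pairing *is* the integral of the product of the Hermite-type functions. -/
theorem gip_eq_integral (p q : MvPolynomial σ ℂ) :
    gip p q = ∫ x : σ → ℝ, hermiteFun p x * hermiteFun q x := by
  simp_rw [hermiteFun_mul_hermiteFun]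
  rfl

/-- **Folland §1.7 (vii) [Fo89 chunk p0047 L21], orthonormality half, as a statement in `L²(ℝⁿ)`**:
the Hermite functions `h_α(x) = (herm α)(x) e^{−π|x|²}` satisfy
`∫_{ℝⁿ} h_α(x) \overline{h_β(x)} dx = δ_{αβ}` (Lebesgue measure on `ℝ^σ`). -/
theorem hermite_orthonormal (α β : σ →₀ ℕ) :
    ∫ x : σ → ℝ, hermiteFun (herm α) x * starRingEnd ℂ (hermiteFun (herm β) x) = if α = β then 1 else 0 := by
  simp_rw [conj_hermiteFun, map_conj_herm]
  rw [← gip_eq_integral]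
  exact gip_herm α β

/-- In particular `‖h_α‖²_{L²} = ∫ |h_α|² = 1`. -/
theorem hermite_norm_sq (α : σ →₀ ℕ) :
    ∫ x : σ → ℝ, hermiteFun (herm α) x * starRingEnd ℂ (hermiteFun (herm α) x) = 1 := by
  rw [hermite_orthonormal, if_pos rfl]

/-- and `h_α ⊥ h_β` for `α ≠ β`. -/
theorem hermite_orthogonal {α β : σ →₀ ℕ} (h : α ≠ β) :
    ∫ x : σ → ℝ, hermiteFun (herm α) x * starRingEnd ℂ (hermiteFun (herm β) x) = 0 := by
  rw [hermite_orthonormal, if_neg h]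

end NDim

end

end HodgeCM.PerL34.Fock.Hermite
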